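import Literature.AlgebraicGeometry.Resolution.HilbertSamuelGenericConstancyExcellent
import Literature.AlgebraicGeometry.Resolution.HilbertSamuelStrata
import Literature.AlgebraicGeometry.Resolution.ExcellentRingsFieldProofs
import Literature.AlgebraicGeometry.Resolution.QuasiExcellentSchemes
import Summits.ResolutionOfSingularities.ResolutionOfSingularities.Theorems.SigmaMaxModifications.Negative.Levels
import Mathlib.AlgebraicGeometry.Noetherian
import HarnessLib

/-!
# `X(≥ ν)` and `X_max` are closed at every level `N ≥ dim X` over a field
# (crux `SigmaMaxModifications`, stmt-ResolutionOfSingularities-18506, line `Sketch`)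

Stub `stub_isClosed_hsMaxLocus_over_field` of the lead skeleton: Cossart–Jannsen–Saito,
LNM 2270, Thm. 2.33 (3) and Lemma 2.36 (a) at the binding level `N = dim X` (and above) for a
scheme `X` locally of finite type and quasi-compact over a field `k`, CONDITIONAL on the sharp
specialisation inequality Thm. 2.33 (1) over a field (`H^N_X(y) ≤ H^N_X(x)` for `y ⤳ x` and
`ψ_X(x) ≤ N`), which enters as the explicit antecedent (it is the neighbouring stub
`stub_hsFun_le_of_specializes_over_field`).

Proof: `X` is Noetherian (`Scheme.isNoetherian_of_finiteType_over_field`) and excellent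
(`Scheme.isExcellent_of_locallyOfFiniteType Stacks07QW_field_holds`); `ψ_X(x) ≤ dim 𝒪_{X,x} ≤
dim X ≤ N` (`Negative.hsPsi_le_of_dim_le`); so the tree's `Scheme.isClosed_hsStratumGE_of_isExcellent`
(Thm. 2.33 (3) reduced to Thm. 2.33 (1), via Thm. 2.33 (2) and Lemma 2.34 (a)) gives the closedness
of every `X(≥ ν)`, `Scheme.finite_hsValues_of_isExcellent` the finiteness of `Σ_X`, and
`Scheme.isClosed_hsMaxLocus` (Lemma 2.36 (a)) the closedness of `X_max`.
-/

set_option linter.dupNamespace false -- mandated namespace of this single-conjunct summit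

noncomputable section

open CategoryTheory AlgebraicGeometry TopologicalSpace Topology
open Literature.AlgebraicGeometry.Resolution Literature.RingTheory.HilbertSamuel

namespace Summit.ResolutionOfSingularities.ResolutionOfSingularities.Theorems.SigmaMaxModifications.Sketch

/-- **`X(≥ ν)` and `X_max` are closed at every level `N ≥ dim X`** for `X` locally of finite
type and quasi-compact over a field (CJS Thm. 2.33 (3), Lemma 2.36 (a) at the binding level
`N = dim X`), from the sharp specialisation inequality Thm. 2.33 (1) over a field (the
antecedent): `Scheme.isClosed_hsStratumGE_of_isExcellent` / `Scheme.isClosed_hsMaxLocus` take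
exactly `ψ_X ≤ N` and that inequality as input, and `ψ_X ≤ dim X ≤ N`.
[cite: CossartJannsenSaito2020, Thm. 2.33 (3), Lemma 2.36 (a)] -/
theorem stub_isClosed_hsMaxLocus_over_field :
    (∀ (k : Type) [Field k] (X : Scheme.{0}) (f : X ⟶ Spec (.of k)), LocallyOfFiniteType f →
      ∀ (N : ℕ) (x y : X), y ⤳ x → Scheme.hsPsi X x ≤ N →
        Scheme.hsFun X N y ≤ Scheme.hsFun X N x) →
    ∀ (k : Type) [Field k] (X : Scheme.{0}) (f : X ⟶ Spec (.of k)), LocallyOfFiniteType f →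
      QuasiCompact f → ∀ N : ℕ, topologicalKrullDim X ≤ (N : WithBot ℕ∞) →
        (∀ ν : ℕ → ℕ, IsClosed (Scheme.hsStratumGE X N ν)) ∧
          IsClosed (Scheme.hsMaxLocus X N) := by
  intro hsharp k _ X f hft hqc N hdim
  haveI := hft
  haveI := hqc
  haveI : IsLocallyNoetherian X := LocallyOfFiniteType.isLocallyNoetherian f
  haveI : IsNoetherian X := Scheme.isNoetherian_of_finiteType_over_field f
  have hexc : Scheme.IsExcellent X :=
    Scheme.isExcellent_of_locallyOfFiniteType Stacks07QW_field_holds f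
  have hψ : ∀ x : X, Scheme.hsPsi X x ≤ N :=
    Summit.ResolutionOfSingularities.ResolutionOfSingularities.Theorems.SigmaMaxModifications.Negative.hsPsi_le_of_dim_le
      hdim
  have husc : ∀ ν : ℕ → ℕ, IsClosed (Scheme.hsStratumGE X N ν) := fun ν =>
    Scheme.isClosed_hsStratumGE_of_isExcellent hexc N hψ
      (fun x y h => hsharp k X f hft N x y h (hψ x)) ν
  have hfin : (Scheme.hsValues X N).Finite := Scheme.finite_hsValues_of_isExcellent hexc N hψ
  exact ⟨husc, Scheme.isClosed_hsMaxLocus husc hfin⟩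

end Summit.ResolutionOfSingularities.ResolutionOfSingularities.Theorems.SigmaMaxModifications.Sketch

end
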